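import Literature.MathematicalPhysics.QuantumFieldTheory.Balaban1983to89.Node00.CarriersB8SubD
import Literature.MathematicalPhysics.QuantumFieldTheory.Balaban1983to89.B11Eq7Convention
import Literature.MathematicalPhysics.QuantumFieldTheory.Balaban1983to89.B8Eq134Admissible

/-!
# `Balaban1983to89.B8IdxB8SubDRigidity` — [Balaban1985RegularSpaces] (1.3)–(1.6) p. 77, (1.68) p. 88: THE (1.5)-OBEYING INDEX OF RECORD `Node00.IdxB8SubD θ` («P₂D»)
# IS EXACTLY PRINT'S CLASS OF ADMISSIBLE DOMAIN SEQUENCES — RIGIDITY (a member's constraint towers at every truncation ARE the (1.5)∕(1.68) level families of its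
# domains, `B11Eq7Convention.Lam θ.L Ω m`), UNIVERSALITY (every admissible `(η, k, Ω)` is carried by a member), and the resulting CHARACTERISATION

statement-level skeleton of published theorems with citation tags; proofs where landed; nothing here is a claim about the Yang–Mills mass gap

T. Bałaban, *Spaces of regular gauge field configurations on a lattice and gauge fixing conditions*, Commun. Math. Phys. **99** (1985) 75–102 `[Balaban1985RegularSpaces]`
("B8"; journal page = PDF page + 74): (1.3)–(1.6) p. 77 («Ω₀ ⊃ Ω₁ ⊃ … ⊃ Ω_k», «Ω_j = Bʲ(Ω_j^{(j)})», «Λ_j = Ω_j^{(j)} ∖ Ω_{j+1}^{(j)}, j = 0, 1, …, k − 1, Λ_k = Ω_k^{(k)}»,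
«Ω_j^{(j)} = ⋃_{l ≥ j} B^{l−j}(Λ_l)», «we admit the case where some domains Ω_j are equal to T_η»), (1.68) p. 88 (the truncated sequences `{Ω_j}_{j ≤ m}`), (1.131) p. 99.
T. Bałaban, *The variational problem and background fields in renormalization group method for lattice gauge theories*, Commun. Math. Phys. **102** (1985) 277–309
`[Balaban1985Variational]` ("B11"), (1)–(3) pp. 277–278: the SAME level sets `Λ_j` for `𝔅_k(𝔅_k, V)` — typed by lit-balaban p29 as `B11Eq7Convention.Lam L Ω k j =
{y ∣ Lʲy ∈ B8Ineq132.layer Ω k j}` (level-`j` coordinates; `layer Ω k j = Ω_j ∖ Ω_{j+1}` for `j < k`, `= Ω_k` at `j = k`).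

WHY (cell `pub-ymgap`, HUMAN RULING D-0062 ∕ D-0149; DAG node N05 = [B8]; width seat `pub-ymgap-dag-n05-w2` g4; proof lane, count-neutral).  The «P₂D» road of record (dag-n05-d
p619291; dag-n05-w1 `Node00/CarriersB8SubD` p615695) keys every class-wide [4]-type binder of N05's leaf on the members `i : ZdIdx` with `Ω₀ = ℤᵈ`, the located laws №7∕№8∕№11∕№12
(`IdxB8LawsB`), the (1.3)–(1.4) record `DomainSeq`, and the (1.5) reading of the TOP constraint family — the Subtype `IdxB8SubD θ`.  A `ZdIdx` datum carries, besides print's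
`(η, k, Ω)`, two whole FAMILIES `Λs m l` (site labels) ∕ `Λb m l` (bond labels); the node's A6∕vacuity history (p613168 `Λs ≡ ⊤`, p613383 extra tops) is the history of their
freedom under the located laws.  THIS FILE closes that question on the index of record: under laws + `DomainSeq` + (1.5) the families are DETERMINED by `(k, Ω)` on every level
anything reads (`l ≤ m ≤ k`) and they are PRINT'S — `Λs m l = B11Eq7Convention.Lam θ.L Ω m l` ((1.5) below the top of the truncation, `Ω_m^{(m)}` at its top, (1.68));
conversely EVERY admissible `(η, k, Ω)` is carried by the canonical datum `⟨η, k, Ω, Lam, towerBonds⟩`.  So `IdxB8SubD θ` is print's class of admissible domain sequences, no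
more and no less; an A6 witness for a (1.5)-keyed binder class at a NAMED `Ω` is one line (§3); a supplier at truncation `m` reads the member's level sets as print's by name (§1).

WHAT IS PROVED (kernel, 0 sorry; theorems only).  §0 dictionary: `loK_eq_smul`, `mem_lamK_iff_of_lt` (`y ∈ B11Eq7Convention.Lam L Ω m l ↔ Lˡ•y ∈ B8ConstraintBonds.Lam L Ω l`,
`l < m`), `mem_lamK_self_iff` (`… m m ↔ Lᵐ•y ∈ Ω m`), `under_trans`, `loK_mem_layer_iff_of_under` (a fine site of the `l`-block of `y` lies in `Ω_l ∖ Ω_{l+1}` iff the corner does),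
`smul_mem_iff_lam_or_block` (№8-at-the-top on the domains: «`Ω_m^{(m)} = Λ_m ∪ B(Ω_{m+1}^{(m+1)})`»), `towerBonds_congr_levels`.  §1 RIGIDITY at a law member `(i, IdxB8Laws, DomainSeq,
hΛ)` (the `IdxB8SubC` + (1.5) form) and on `IdxB8SubD`: ★ `mem_top_iff_lam_of_lamTop` (the typed ONE-SIDED (1.5) is an IFF — №11 `cover` + `htower` + `sat`),
`mem_top_self_iff_of_laws` (`z ∈ Λs k k ↔ Lᵏ•z ∈ Ω_k`), ★ `mem_trunc_iff_of_lamTop` (both at EVERY truncation `m ≤ k`, №8 downward), ★★ `Λs_eq_lam_of_lamTop`,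
`Λb_eq_towerBonds_lam_of_lamTop`; ★★ `IdxB8SubD.Λs_eq_lam` (`Λs m l = B11Eq7Convention.Lam θ.L Ω m l`, `l ≤ m ≤ k`), `IdxB8SubD.mem_Λs_iff_lam` ((1.5) IFF at every truncation — r05's
`B8Eq131DomainSeq` hypothesis shape `hΛ` BY NAME), `IdxB8SubD.mem_Λs_self_iff`, `IdxB8SubD.lamTop_trunc` (the Subtype's predicate is HEREDITARY to every truncation),
`IdxB8SubD.Λb_eq_towerBonds_lam` (№12 over print's families), `IdxB8SubD.Λs_eq_of_eq` ∕ `IdxB8SubD.Λb_eq_of_eq` (same `(k, Ω)` ⇒ same towers and bond classes on `l ≤ m ≤ k`),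
`IdxB8SubC.lamTop_iff_Λs_eq_lam`.  §2 UNIVERSALITY: ★★ `exists_zdIdx_lam_lawsB` (the canonical datum is a `ZdIdx` obeying `IdxB8LawsB`), ★★★ `exists_idxB8SubD_of_domainSeq`, ★★★
`exists_idxB8SubD_iff` (`(∃ j, j.η = η ∧ j.k = k ∧ j.Ω = Ω) ↔ 0 < η ∧ 1 ≤ k ∧ Lᵏη ≤ 1 ∧ Ω 0 = univ ∧ DomainSeq θ.L Ω`).  §3 A6 by one line for named families: ★★
`exists_idxB8SubD_of_admissible134` (PRINT'S LITERAL (1.3)–(1.4) with `M₁`-cubes and metric clause, `RM₁ ≥ L` — r05's `B8Eq134Admissible.Admissible134`), ★ `exists_idxB8SubD_cubeFam`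
(print's tower `(ℤᵈ, □₁, …, □_k)` at every centre, size, margin `ρ ≥ L`, depth, spacing `L⁻ᵏ` — generalising `Node00.exists_idxB8SubD_depth`), `exists_idxB8SubD_cubeSeq`, ★ `IdxB8SubD.exists_truncation` ((1.68): truncations
of members are members, families agreeing on `l ≤ m' ≤ m` — the induction step of Theorem 4 on the index of record).

HONEST SCOPE.  Lattice-geometric bookkeeping about WHICH DATA a member of the index carries; NO estimate of [Balaban1985RegularSpaces] ∕ [4] proved or asserted; nothing about the
carriers' fields, sockets or letters; junk levels (`l > m` or `m > k`, read by nothing) stay free as typed.  Count-neutral; N05 NOT discharged; K1⁸ `stmt-QuantumFields-26907` OPEN; no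
count claim (the chair's single count line is the only count); `T_η ↦ ℤᵈ`; one finite `𝕋⁴` programme at fixed `ε`, Bałaban AS PRINTED; the Yang–Mills mass gap (Clay) is NOT proved by
any of this — R4 closes the conditional finite-`𝕋⁴` rung `BalabanLadder.UV` only; nothing continuum ∕ ℝ⁴ ∕ OS.  No `sorry` ∕ `def` ∕ `instance` ∕ `notation`.  `pub-ymgap-dag-n05-w2` (g4), 2026-08-28.
RELATED, USED BY NAME, NOT DUPLICATED: `Node00/CarriersB8SubD` (dag-n05-w1), `Node00/CarriersB8Sub` (`IdxB8Laws`), `B8IdxB8LawsB` (dag-n05-c: `towerBonds`, `_hbox∕_hclass`), `B8ConstraintBonds`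
∕ `B8Eq131DomainSeq` ∕ `B8Eq134Admissible` ∕ `B8Eq131Cubes(Admissible)` (r05), `B11Eq7Convention` (p29), `B8Ineq132` (`Under`, `layer`, `exists_layer`), `B8CubeMemberZd`, `B8Eq191FlatLettersCubeMember`,
`B8Eq131Derivation`, `B8TowerBondsLayerLawSubC` (this seat g3: the pinned tower; §3 now gives it at every centre∕size∕margin).
[cite: Balaban1985RegularSpaces, (1.3)–(1.6) p.77, (1.68) p.88, (1.131) p.99; Balaban1985Variational, (1)–(3) pp.277–278]
-/

noncomputable section

namespace Literature.MathematicalPhysics.QuantumFieldTheory.Balaban1983to89.B8IdxB8SubDRigidity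

open Literature.MathematicalPhysics.QuantumLattice (blockMap blockSites mem_blockSites_iff)
open B7Prop1Explicit B7Prop1Local
open B8Ineq132 (Under layer exists_layer)
open B8Ineq130 (tlo thi)
open B8LeafModelZd (ZdIdx)
open B8ConstraintBonds (DomainSeq Lam IsLevel)
open B8IdxB8LawsB (IdxB8LawsB IdxB8SubB towerBonds mem_towerBonds_iff towerBonds_hbox towerBonds_hclass)
open B8Eq131DomainSeq (isLevel_pow_smul)
open B11Eq7Convention (blockMap_eq_of_under under_loK_self mem_iff_of_under)
open B8CubeMemberZd (inBox_tower_iff_under under_smul_iff)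
open B8Eq191FlatLettersCubeMember (under_iff_blockMap_eq)
open B8Eq131Derivation (under_zero_iff)
open B8Eq131Cubes (flm under_flm)
open B8Eq131CubesAdmissible (cubeFam cubeFam_domainSeq cubeFam_true_zero)
open B8Eq134Admissible (Admissible134)
open B8ConstraintBonds (cubeSeq cubeSeq_domainSeq)
open Node00 (Stage3Params IdxB8Laws IdxB8SubC IdxB8SubD)

-- `Site` alone could resolve to the torus sites of `Setup.lean`; re-export the `ℤ^d` sites of `B7Prop1Explicit`.
export B7Prop1Explicit (Site)

variable {d : ℕ}

/-! ## §0 Dictionary: level coordinates, corners, blocks -/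

/-- The corner `loK L j y` of the `j`-block labelled `y` is the fine point `Lʲ•y` of the B8 lineage's reading. [cite: Balaban1985RegularSpaces, (1.5) p.77 (bookkeeping)] -/
theorem loK_eq_smul (L j : ℕ) (y : Site d) : loK L j y = ((L : ℤ) ^ j) • y := by
  funext i; simp [loK, Pi.smul_apply]

/-- **[B11]'s level family below the top of the truncation IS (1.5)**: for `l < m`, `y ∈ B11Eq7Convention.Lam L Ω m l ↔ Lˡ•y ∈ Λ_l = Ω_l^{(l)} ∖ Ω_{l+1}^{(l)}` (the level
condition of `B8ConstraintBonds.Lam` is automatic for a corner). [cite: Balaban1985RegularSpaces, (1.5) p.77; Balaban1985Variational, (3) p.278] -/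
theorem mem_lamK_iff_of_lt (L : ℕ) (Ω : ℕ → Set (Site d)) {m l : ℕ} (hl : l < m) (y : Site d) :
    y ∈ B11Eq7Convention.Lam L Ω m l ↔ ((L : ℤ) ^ l) • y ∈ Lam L Ω l := by
  simp only [B11Eq7Convention.Lam, Set.mem_setOf_eq, layer, loK_eq_smul, Lam]
  exact ⟨fun h => ⟨isLevel_pow_smul L l y, h.1, h.2 hl⟩, fun h => ⟨h.2.1, fun _ => h.2.2⟩⟩

/-- **[B11]'s level family at the top of the truncation IS `Ω_m^{(m)}`** ((1.5) «Λ_k = Ω_k^{(k)}», (1.68)): `y ∈ B11Eq7Convention.Lam L Ω m m ↔ Lᵐ•y ∈ Ω_m`.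
[cite: Balaban1985RegularSpaces, (1.5) p.77, (1.68) p.88; Balaban1985Variational, (3) p.278] -/
theorem mem_lamK_self_iff (L : ℕ) (Ω : ℕ → Set (Site d)) (m : ℕ) (y : Site d) :
    y ∈ B11Eq7Convention.Lam L Ω m m ↔ ((L : ℤ) ^ m) • y ∈ Ω m := by
  simp only [B11Eq7Convention.Lam, Set.mem_setOf_eq, layer, loK_eq_smul, lt_irrefl, IsEmpty.forall_iff, and_true]

/-- Blocks compose: a fine site of the `l`-block of a label `z` which itself lies in the `n`-block of `y` lies in the `(n + l)`-block of `y` («B^{l−j}(Λ_l)» iterated).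
[cite: Balaban1985RegularSpaces, (1.6) p.77] -/
theorem under_trans {L n l : ℕ} {y z x : Site d} (h₁ : Under L n y z) (h₂ : Under L l z x) : Under L (n + l) y x := by
  intro i
  obtain ⟨a1, a2⟩ := h₁ i
  obtain ⟨b1, b2⟩ := h₂ i
  have hLl : (0 : ℤ) ≤ (L : ℤ) ^ l := by positivity
  rw [pow_add]
  constructor
  · calc (L : ℤ) ^ n * (L : ℤ) ^ l * y i = (L : ℤ) ^ l * ((L : ℤ) ^ n * y i) := by ring
      _ ≤ (L : ℤ) ^ l * z i := mul_le_mul_of_nonneg_left a1 hLl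
      _ ≤ x i := b1
  · calc x i + 1 ≤ (L : ℤ) ^ l * (z i + 1) := b2
      _ ≤ (L : ℤ) ^ l * ((L : ℤ) ^ n * (y i + 1)) := mul_le_mul_of_nonneg_left a2 hLl
      _ = (L : ℤ) ^ n * (L : ℤ) ^ l * (y i + 1) := by ring

/-- **«Ω_j = Bʲ(Ω_j^{(j)})» at two consecutive levels**: under (1.3)–(1.4), a fine site `x` of the `l`-block of `y` lies in the layer `Ω_l ∖ Ω_{l+1}` (`B8Ineq132.layer Ω k l`; just `Ω_k`
at `l = k`) iff the corner `Lˡy` does (`sat` at `l` and at `l + 1`, the latter through the `(l+1)`-block containing both). [cite: Balaban1985RegularSpaces, (1.4)–(1.6) p.77] -/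
theorem loK_mem_layer_iff_of_under {L : ℕ} (hL : 1 ≤ L) {Ω : ℕ → Set (Site d)} (hΩ : DomainSeq L Ω) {k l : ℕ} {y x : Site d}
    (hux : Under L l y x) : loK L l y ∈ layer Ω k l ↔ x ∈ layer Ω k l := by
  have h0 : x ∈ Ω l ↔ loK L l y ∈ Ω l := mem_iff_of_under hL hΩ hux
  -- both `x` and the corner lie in the `(l+1)`-block of `flm L 1 y`
  have h1 : Under L 1 (flm L 1 y) y := under_flm hL 1 y
  have hx' : Under L (1 + l) (flm L 1 y) x := under_trans h1 hux
  have hc' : Under L (1 + l) (flm L 1 y) (loK L l y) := by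
    rw [loK_eq_smul]; exact (under_smul_iff hL 1 l (flm L 1 y) y).2 h1
  have h2 : x ∈ Ω (l + 1) ↔ loK L l y ∈ Ω (l + 1) := by
    rw [Nat.add_comm l 1]
    exact (mem_iff_of_under hL hΩ hx').trans (mem_iff_of_under hL hΩ hc').symm
  simp only [layer, Set.mem_setOf_eq]
  rw [h0, h2]

/-- **№8 at the top of a truncation, on the domains** («Ω_m^{(m)} = Λ_m ∪ (the m-blocks of Ω_{m+1}^{(m+1)})», the set identity behind `IdxB8Laws.trunc_top` and (1.68)): under (1.3)–(1.4),
`Lᵐx ∈ Ω_m` iff `Lᵐx ∈ Λ_m` or `x` lies in the `L`-block of a label `y` with `L^{m+1}y ∈ Ω_{m+1}`. [cite: Balaban1985RegularSpaces, (1.3)–(1.6) p.77, (1.68) p.88] -/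
theorem smul_mem_iff_lam_or_block {L : ℕ} (hL : 1 ≤ L) {Ω : ℕ → Set (Site d)} (hΩ : DomainSeq L Ω) (m : ℕ) (x : Site d) :
    ((L : ℤ) ^ m) • x ∈ Ω m ↔ ((L : ℤ) ^ m) • x ∈ Lam L Ω m ∨ ∃ y, ((L : ℤ) ^ (m + 1)) • y ∈ Ω (m + 1) ∧ x ∈ blockSites L y := by
  haveI : NeZero L := ⟨by omega⟩
  -- the `(m+1)`-block of a label `y` contains `Lᵐx` as soon as the `L`-block of `y` contains `x`
  have key : ∀ y : Site d, Under L 1 y x → (((L : ℤ) ^ m) • x ∈ Ω (m + 1) ↔ ((L : ℤ) ^ (m + 1)) • y ∈ Ω (m + 1)) := by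
    intro y hy
    have h' : Under L (1 + m) y (((L : ℤ) ^ m) • x) := (under_smul_iff hL 1 m y x).2 hy
    rw [Nat.add_comm 1 m] at h'
    rw [mem_iff_of_under hL hΩ h', loK_eq_smul]
  constructor
  · intro h
    by_cases h1 : ((L : ℤ) ^ m) • x ∈ Ω (m + 1)
    · refine Or.inr ⟨flm L 1 x, (key _ (under_flm hL 1 x)).1 h1, ?_⟩
      rw [mem_blockSites_iff]
      have := blockMap_eq_of_under (under_flm hL 1 x)
      rwa [pow_one] at this
    · exact Or.inl ⟨isLevel_pow_smul L m x, h, h1⟩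
  · rintro (h | ⟨y, hy, hxy⟩)
    · exact h.2.1
    · have hu : Under L 1 y x := by
        rw [under_iff_blockMap_eq hL 1 y x, pow_one]; exact (mem_blockSites_iff L y x).1 hxy
      exact hΩ.anti m (((key y hu).2 hy))

/-- The tower-generated bond class at level `j` reads the site families at levels `j` and `j − 1` only (congruence for `towerBonds`; №12 bookkeeping).
[cite: Balaban1985RegularSpaces, (1.31) p.82, p.86 («𝔅_k»)] -/
theorem towerBonds_congr_levels (L : ℕ) (Ω : ℕ → Set (Site d)) {Λ Λ' : ℕ → Set (Site d)} {j : ℕ} (hj : Λ j = Λ' j)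
    (hj' : ∀ j', j = j' + 1 → Λ j' = Λ' j') : towerBonds L Ω Λ j = towerBonds L Ω Λ' j := by
  ext c
  rw [mem_towerBonds_iff, mem_towerBonds_iff, hj]
  refine and_congr_right fun _ => or_congr Iff.rfl (or_congr ?_ ?_)
  · refine exists_congr fun j' => and_congr_right fun hjj => ?_
    rw [hj' j' hjj]
  · refine exists_congr fun j' => and_congr_right fun hjj => ?_
    rw [hj' j' hjj]

/-! ## §1 RIGIDITY: under the laws, (1.3)–(1.4) and the (1.5) reading of the top family, the constraint towers ARE print's level families of the domains -/

section LawMember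

variable {L : ℕ}

/-- ★ **THE TYPED ONE-SIDED (1.5) IS AN IFF**: at a law member with (1.3)–(1.4) whose top family reads (1.5) (`hΛ`, the `IdxB8SubD` predicate), for every level `l < k`:
`z ∈ Λs k l ↔ Lˡ•z ∈ Λ_l`.  (←): the `l`-block of `z` lies in `Ω_l` (`sat`), so №11 `cover` puts `z` under some top label `y ∈ Λs k j`, `j ≥ l`; `j > l` would put the corner `Lˡz` in
`Ω_j ⊆ Ω_{l+1}` (`htower`, (1.3)) — excluded by `Lˡz ∉ Ω_{l+1}`; so `j = l` and `y = z`. [cite: Balaban1985RegularSpaces, (1.5)–(1.6) p.77] -/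
theorem mem_top_iff_lam_of_lamTop (hL : 1 ≤ L) (i : ZdIdx d L) (hlaws : IdxB8Laws L i) (hΩ : DomainSeq L i.Ω)
    (hΛ : ∀ l, l < i.k → ∀ z ∈ i.Λs i.k l, ((L : ℤ) ^ l) • z ∈ Lam L i.Ω l) {l : ℕ} (hl : l < i.k) (z : Site d) :
    z ∈ i.Λs i.k l ↔ ((L : ℤ) ^ l) • z ∈ Lam L i.Ω l := by
  refine ⟨hΛ l hl z, fun h => ?_⟩
  have htow : ∀ x, InBox (tlo L z l) (thi L z l) x → x ∈ i.Ω l := fun x hx =>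
    (mem_iff_of_under hL hΩ ((inBox_tower_iff_under L l z x).1 hx)).2 (by rw [loK_eq_smul]; exact h.2.1)
  obtain ⟨j, hlj, hjk, y, hy, hu⟩ := hlaws.cover l hl.le z htow
  rcases hlj.eq_or_lt with rfl | hlt
  · rw [Nat.sub_self] at hu
    rw [(under_zero_iff L y z).1 hu]; exact hy
  · exfalso
    have hc : Under L j y (((L : ℤ) ^ l) • z) := by
      have h' := (under_smul_iff hL (j - l) l y z).2 hu
      rwa [Nat.sub_add_cancel hlj] at h'
    have hmem : ((L : ℤ) ^ l) • z ∈ i.Ω j := i.htower j hjk y hy _ ((inBox_tower_iff_under L j y _).2 hc)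
    exact h.2.2 (hΩ.anti_le (by omega : l + 1 ≤ j) hmem)

/-- **THE TOP LEVEL OF THE TOP FAMILY IS `Ω_k^{(k)}`** («Λ_k = Ω_k^{(k)}»): at a law member with (1.3)–(1.4), `z ∈ Λs k k ↔ Lᵏ•z ∈ Ω_k` (`htower` one way; `sat` + №11 `cover` at `ℓ = k` the
other).  No (1.5) hypothesis needed. [cite: Balaban1985RegularSpaces, (1.5)–(1.6) p.77] -/
theorem mem_top_self_iff_of_laws (hL : 1 ≤ L) (i : ZdIdx d L) (hlaws : IdxB8Laws L i) (hΩ : DomainSeq L i.Ω) (z : Site d) :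
    z ∈ i.Λs i.k i.k ↔ ((L : ℤ) ^ i.k) • z ∈ i.Ω i.k := by
  refine ⟨fun hz => i.htower i.k le_rfl z hz _ ((inBox_tower_iff_under L i.k z _).2 ?_), fun h => ?_⟩
  · rw [← loK_eq_smul]; exact under_loK_self hL i.k z
  · have htow : ∀ x, InBox (tlo L z i.k) (thi L z i.k) x → x ∈ i.Ω i.k := fun x hx =>
      (mem_iff_of_under hL hΩ ((inBox_tower_iff_under L i.k z x).1 hx)).2 (by rw [loK_eq_smul]; exact h)
    obtain ⟨j, hkj, hjk, y, hy, hu⟩ := hlaws.cover i.k le_rfl z htow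
    have hj : j = i.k := le_antisymm hjk hkj
    rw [hj, Nat.sub_self] at hu
    rw [hj] at hy
    rw [(under_zero_iff L y z).1 hu]; exact hy

/-- ★ **RIGIDITY AT EVERY TRUNCATION `m ≤ k`** (№8 `trunc_lt` ∕ `trunc_top` downward from the top): below the top of the truncation the family reads (1.5) as an IFF, at the top it is
`Ω_m^{(m)}` — exactly print's truncated sequence (1.68). [cite: Balaban1985RegularSpaces, (1.5)–(1.6) p.77, (1.68) p.88] -/
theorem mem_trunc_iff_of_lamTop (hL : 1 ≤ L) (i : ZdIdx d L) (hlaws : IdxB8Laws L i) (hΩ : DomainSeq L i.Ω)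
    (hΛ : ∀ l, l < i.k → ∀ z ∈ i.Λs i.k l, ((L : ℤ) ^ l) • z ∈ Lam L i.Ω l) :
    ∀ m, m ≤ i.k →
      (∀ l, l < m → ∀ z : Site d, z ∈ i.Λs m l ↔ ((L : ℤ) ^ l) • z ∈ Lam L i.Ω l) ∧
        ∀ z : Site d, z ∈ i.Λs m m ↔ ((L : ℤ) ^ m) • z ∈ i.Ω m := by
  suffices h : ∀ n m, m + n = i.k →
      (∀ l, l < m → ∀ z : Site d, z ∈ i.Λs m l ↔ ((L : ℤ) ^ l) • z ∈ Lam L i.Ω l) ∧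
        ∀ z : Site d, z ∈ i.Λs m m ↔ ((L : ℤ) ^ m) • z ∈ i.Ω m from
    fun m hm => h (i.k - m) m (by omega)
  intro n
  induction n with
  | zero =>
    intro m hm
    rw [Nat.add_zero] at hm
    subst hm
    exact ⟨fun l hl z => mem_top_iff_lam_of_lamTop hL i hlaws hΩ hΛ hl z, fun z => mem_top_self_iff_of_laws hL i hlaws hΩ z⟩
  | succ n ih =>
    intro m hm
    have hmk : m < i.k := by omega
    obtain ⟨ihA, ihB⟩ := ih (m + 1) (by omega)
    refine ⟨fun l hl z => ?_, fun z => ?_⟩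
    · rw [hlaws.trunc_lt m hmk l hl]; exact ihA l (by omega) z
    · rw [hlaws.trunc_top m hmk z, smul_mem_iff_lam_or_block hL hΩ m z, ihA m (Nat.lt_succ_self m) z]
      refine or_congr Iff.rfl ⟨?_, ?_⟩
      · rintro ⟨y, hy, hzy⟩; exact ⟨y, (ihB y).1 hy, hzy⟩
      · rintro ⟨y, hy, hzy⟩; exact ⟨y, (ihB y).2 hy, hzy⟩

/-- ★★ **RIGIDITY AS A SET EQUATION**: at a law member with (1.3)–(1.4) whose top family reads (1.5), for every truncation `m ≤ k` and every level `l ≤ m`,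
`Λs m l = B11Eq7Convention.Lam L Ω m l` — [B11] (3)'s typed level sets of the truncated domain sequence `{Ω_j}_{j ≤ m}`.  The member carries NO datum beyond `(k, Ω)` on these levels.
[cite: Balaban1985RegularSpaces, (1.5)–(1.6) p.77, (1.68) p.88; Balaban1985Variational, (1)–(3) pp.277–278] -/
theorem Λs_eq_lam_of_lamTop (hL : 1 ≤ L) (i : ZdIdx d L) (hlaws : IdxB8Laws L i) (hΩ : DomainSeq L i.Ω)
    (hΛ : ∀ l, l < i.k → ∀ z ∈ i.Λs i.k l, ((L : ℤ) ^ l) • z ∈ Lam L i.Ω l) {m : ℕ} (hm : m ≤ i.k) {l : ℕ} (hl : l ≤ m) :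
    i.Λs m l = B11Eq7Convention.Lam L i.Ω m l := by
  obtain ⟨hA, hB⟩ := mem_trunc_iff_of_lamTop hL i hlaws hΩ hΛ m hm
  ext z
  rcases hl.lt_or_eq with hlt | rfl
  · rw [hA l hlt z, mem_lamK_iff_of_lt L i.Ω hlt z]
  · rw [hB z, mem_lamK_self_iff]

/-- **№12 OVER THE CANONICAL FAMILIES**: at such a member obeying also the bond law, for `l ≤ m ≤ k` the bond class `Λb m l` is the tower-generated class of PRINT'S level sets
(`towerBonds` reads levels `l`, `l − 1` only). [cite: Balaban1985RegularSpaces, (1.31) p.82, p.86 («𝔅_k»), (1.5) p.77] -/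
theorem Λb_eq_towerBonds_lam_of_lamTop (hL : 1 ≤ L) (i : ZdIdx d L) (hlaws : IdxB8LawsB L i) (hΩ : DomainSeq L i.Ω)
    (hΛ : ∀ l, l < i.k → ∀ z ∈ i.Λs i.k l, ((L : ℤ) ^ l) • z ∈ Lam L i.Ω l) {m : ℕ} (hm : m ≤ i.k) {l : ℕ} (hl : l ≤ m) :
    i.Λb m l = towerBonds L i.Ω (B11Eq7Convention.Lam L i.Ω m) l := by
  rw [hlaws.bonds m l]
  exact towerBonds_congr_levels L i.Ω (Λs_eq_lam_of_lamTop hL i hlaws.toIdxB8Laws hΩ hΛ hm hl)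
    fun j' hj => Λs_eq_lam_of_lamTop hL i hlaws.toIdxB8Laws hΩ hΛ hm (by omega)

end LawMember

/-! ### The faces on the (1.5)-obeying index of record `IdxB8SubD θ` (laws, (1.3)–(1.4), (1.5) are FIELDS: nothing displayed) and on the «P₂C» index `IdxB8SubC θ` -/

section SubD

/-- `1 ≤ θ.L` (Bałaban's block size is odd `> 1`; private plumbing). [folklore] -/
private theorem one_le_L (θ : Stage3Params) : 1 ≤ θ.L := le_trans (by norm_num) θ.two_le_L

variable {θ : Stage3Params}

/-- ★★ **RIGIDITY ON THE INDEX OF RECORD**: for every `j : IdxB8SubD θ`, every truncation `m ≤ k` and level `l ≤ m`, the constraint family IS print's level set of the member's domains: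
`j.Λs m l = B11Eq7Convention.Lam θ.L j.Ω m l`. [cite: Balaban1985RegularSpaces, (1.5)–(1.6) p.77, (1.68) p.88; Balaban1985Variational, (3) p.278] -/
theorem IdxB8SubD.Λs_eq_lam (j : IdxB8SubD θ) {m : ℕ} (hm : m ≤ j.1.1.1.1.k) {l : ℕ} (hl : l ≤ m) :
    j.1.1.1.1.Λs m l = B11Eq7Convention.Lam θ.L j.1.1.1.1.Ω m l :=
  Λs_eq_lam_of_lamTop (one_le_L θ) j.1.1.1.1 j.1.1.2.toIdxB8Laws j.1.2 j.2 hm hl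

/-- ★ **(1.5) AS AN IFF AT EVERY TRUNCATION** on the index of record (`l < m ≤ k`): `z ∈ Λs m l ↔ Lˡ•z ∈ Λ_l` — the hypothesis shape `hΛ : ∀ j y, y ∈ Λ j ↔ Lʲ•y ∈ Lam L Ω j` of r05's
`B8Eq131DomainSeq` (the crossing-bond geometry of (1.31)∕(1.37)) holds at every member BY NAME. [cite: Balaban1985RegularSpaces, (1.5) p.77, (1.68) p.88, (1.31) p.82] -/
theorem IdxB8SubD.mem_Λs_iff_lam (j : IdxB8SubD θ) {m : ℕ} (hm : m ≤ j.1.1.1.1.k) {l : ℕ} (hl : l < m) (z : Site θ.D) :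
    z ∈ j.1.1.1.1.Λs m l ↔ ((θ.L : ℤ) ^ l) • z ∈ Lam θ.L j.1.1.1.1.Ω l :=
  (mem_trunc_iff_of_lamTop (one_le_L θ) j.1.1.1.1 j.1.1.2.toIdxB8Laws j.1.2 j.2 m hm).1 l hl z

/-- **The top family of every truncation is `Ω_m^{(m)}`** on the index of record: `z ∈ Λs m m ↔ Lᵐ•z ∈ Ω_m` (`m ≤ k`). [cite: Balaban1985RegularSpaces, (1.5) p.77, (1.68) p.88] -/
theorem IdxB8SubD.mem_Λs_self_iff (j : IdxB8SubD θ) {m : ℕ} (hm : m ≤ j.1.1.1.1.k) (z : Site θ.D) :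
    z ∈ j.1.1.1.1.Λs m m ↔ ((θ.L : ℤ) ^ m) • z ∈ j.1.1.1.1.Ω m :=
  (mem_trunc_iff_of_lamTop (one_le_L θ) j.1.1.1.1 j.1.1.2.toIdxB8Laws j.1.2 j.2 m hm).2 z

/-- ★ **THE (1.5) PREDICATE OF `IdxB8SubD` IS HEREDITARY TO EVERY TRUNCATION**: for `m ≤ k`, every label `z ∈ Λs m l` of level `l < m` has its corner in the layer `Λ_l` (the Subtype's field
`j.2` is the case `m = k`). [cite: Balaban1985RegularSpaces, (1.5) p.77, (1.68) p.88] -/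
theorem IdxB8SubD.lamTop_trunc (j : IdxB8SubD θ) {m : ℕ} (hm : m ≤ j.1.1.1.1.k) :
    ∀ l, l < m → ∀ z ∈ j.1.1.1.1.Λs m l, ((θ.L : ℤ) ^ l) • z ∈ Lam θ.L j.1.1.1.1.Ω l :=
  fun _ hl z hz => (IdxB8SubD.mem_Λs_iff_lam j hm hl z).1 hz

/-- **№12 over the canonical families on the index of record** (`l ≤ m ≤ k`): `j.Λb m l = towerBonds θ.L j.Ω (B11Eq7Convention.Lam θ.L j.Ω m) l`.
[cite: Balaban1985RegularSpaces, (1.31) p.82, p.86 («𝔅_k»), (1.5) p.77] -/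
theorem IdxB8SubD.Λb_eq_towerBonds_lam (j : IdxB8SubD θ) {m : ℕ} (hm : m ≤ j.1.1.1.1.k) {l : ℕ} (hl : l ≤ m) :
    j.1.1.1.1.Λb m l = towerBonds θ.L j.1.1.1.1.Ω (B11Eq7Convention.Lam θ.L j.1.1.1.1.Ω m) l :=
  Λb_eq_towerBonds_lam_of_lamTop (one_le_L θ) j.1.1.1.1 j.1.1.2 j.1.2 j.2 hm hl

/-- **TWO MEMBERS WITH THE SAME `(k, Ω)` HAVE THE SAME CONSTRAINT TOWERS** on every level anything reads (`l ≤ m ≤ k`). [cite: Balaban1985RegularSpaces, (1.5)–(1.6) p.77, (1.68) p.88] -/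
theorem IdxB8SubD.Λs_eq_of_eq (j j' : IdxB8SubD θ) (hk : j.1.1.1.1.k = j'.1.1.1.1.k) (hΩ : j.1.1.1.1.Ω = j'.1.1.1.1.Ω)
    {m : ℕ} (hm : m ≤ j.1.1.1.1.k) {l : ℕ} (hl : l ≤ m) : j.1.1.1.1.Λs m l = j'.1.1.1.1.Λs m l := by
  rw [IdxB8SubD.Λs_eq_lam j hm hl, IdxB8SubD.Λs_eq_lam j' (hk ▸ hm) hl, hΩ]

/-- **… and the same constraint-bond classes** (`l ≤ m ≤ k`). [cite: Balaban1985RegularSpaces, p.86 («𝔅_k»), (1.5) p.77] -/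
theorem IdxB8SubD.Λb_eq_of_eq (j j' : IdxB8SubD θ) (hk : j.1.1.1.1.k = j'.1.1.1.1.k) (hΩ : j.1.1.1.1.Ω = j'.1.1.1.1.Ω)
    {m : ℕ} (hm : m ≤ j.1.1.1.1.k) {l : ℕ} (hl : l ≤ m) : j.1.1.1.1.Λb m l = j'.1.1.1.1.Λb m l := by
  rw [IdxB8SubD.Λb_eq_towerBonds_lam j hm hl, IdxB8SubD.Λb_eq_towerBonds_lam j' (hk ▸ hm) hl, hΩ]

/-- **ON THE «P₂C» INDEX THE (1.5) READING IS THE SET EQUATION AT THE TOP**: for `j : IdxB8SubC θ`, the one-sided (1.5) text (the `IdxB8SubD` predicate) holds iff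
`∀ l < k, j.Λs k l = B11Eq7Convention.Lam θ.L j.Ω k l`. [cite: Balaban1985RegularSpaces, (1.5)–(1.6) p.77; Balaban1985Variational, (3) p.278] -/
theorem IdxB8SubC.lamTop_iff_Λs_eq_lam (j : IdxB8SubC θ) :
    (∀ l, l < j.1.1.1.k → ∀ z ∈ j.1.1.1.Λs j.1.1.1.k l, ((θ.L : ℤ) ^ l) • z ∈ Lam θ.L j.1.1.1.Ω l) ↔
      ∀ l, l < j.1.1.1.k → j.1.1.1.Λs j.1.1.1.k l = B11Eq7Convention.Lam θ.L j.1.1.1.Ω j.1.1.1.k l := by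
  refine ⟨fun hΛ l hl => Λs_eq_lam_of_lamTop (one_le_L θ) j.1.1.1 j.1.2.toIdxB8Laws j.2 hΛ le_rfl hl.le, fun h l hl z hz => ?_⟩
  rw [h l hl] at hz
  exact (mem_lamK_iff_of_lt θ.L _ hl z).1 hz

end SubD

/-! ## §2 UNIVERSALITY: every admissible `(η, k, Ω)` is carried by a member — the canonical datum `⟨η, k, Ω, Lam, towerBonds⟩` -/

section Universality

variable {L : ℕ}

/-- The corner of the `l`-block through a point of the layer `Ω_l ∖ Ω_{l+1}` is a label of [B11]'s level family (plumbing for `hpart` ∕ №11). [cite: Balaban1985RegularSpaces, (1.4)–(1.6) p.77] -/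
private theorem flm_mem_lam_of_mem_layer (hL : 1 ≤ L) {Ω : ℕ → Set (Site d)} (hΩ : DomainSeq L Ω) {k l n : ℕ} {w : Site d} {x : Site d}
    (hux : Under L l (flm L n w) x) (hx : x ∈ layer Ω k l) : flm L n w ∈ B11Eq7Convention.Lam L Ω k l :=
  (loK_mem_layer_iff_of_under hL hΩ hux).2 hx

/-- ★★ **THE CANONICAL DATUM OF AN ADMISSIBLE DOMAIN SEQUENCE IS A LAWFUL MEMBER**: for `L ≥ 1`, `0 < η`, `k ≥ 1`, `Lᵏη ≤ 1` and `Ω` obeying (1.3)–(1.4) (`DomainSeq`), the datum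
`⟨η, k, Ω, Λs := B11Eq7Convention.Lam L Ω, Λb := towerBonds⟩` is a `ZdIdx` (`hbox` ∕ `hclass` by `towerBonds_hbox` ∕ `_hclass`; `htower` by `sat`; `hpart` by the largest level
containing the site, `B8Ineq132.exists_layer`) obeying №7 ∕ №8 ∕ №11 ∕ №12 (`IdxB8LawsB`). [cite: Balaban1985RegularSpaces, (1.3)–(1.6) p.77, (1.68) p.88, p.86 («𝔅_k»); Balaban1985Variational, (1)–(3) pp.277–278] -/
theorem exists_zdIdx_lam_lawsB (hL : 1 ≤ L) {η : ℝ} (hη : 0 < η) {k : ℕ} (hk : 1 ≤ k) (hscale : (L : ℝ) ^ k * η ≤ 1)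
    (Ω : ℕ → Set (Site d)) (hΩ : DomainSeq L Ω) :
    ∃ i : ZdIdx d L, i.η = η ∧ i.k = k ∧ i.Ω = Ω ∧ i.Λs = B11Eq7Convention.Lam L Ω ∧
      (∀ m j, i.Λb m j = towerBonds L Ω (B11Eq7Convention.Lam L Ω m) j) ∧ IdxB8LawsB L i := by
  -- corners lie in their own towers
  have hcorner : ∀ (j : ℕ) (y : Site d), InBox (tlo L y j) (thi L y j) (loK L j y) := fun j y =>
    (inBox_tower_iff_under L j y _).2 (under_loK_self hL j y)
  refine ⟨⟨η, hη, k, hk, Ω, hΩ.anti, B11Eq7Convention.Lam L Ω, fun m j => towerBonds L Ω (B11Eq7Convention.Lam L Ω m) j,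
    towerBonds_hbox L Ω _ k, towerBonds_hclass L Ω _ k, ?_, ?_⟩, rfl, rfl, rfl, rfl, fun _ _ => rfl, ?_⟩
  · -- htower: the `j`-tower of a label of the level family lies in `Ω_j` (`sat`)
    intro j _ y hy x hx
    exact (mem_iff_of_under hL hΩ ((inBox_tower_iff_under L j y x).1 hx)).2 hy.1
  · -- hpart: a site of `Ω₀` lies in the tower of the label of its block at the largest level `l ≤ k` with `x ∈ Ω_l`
    intro x hx
    obtain ⟨l, -, hlk, hxl⟩ := exists_layer (Ω := Ω) (Nat.zero_le k) hx
    exact ⟨l, hlk, flm L l x, flm_mem_lam_of_mem_layer hL hΩ (under_flm hL l x) hxl, (inBox_tower_iff_under L l _ x).2 (under_flm hL l x)⟩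
  · -- the located laws
    refine ⟨⟨hscale, ?_, ?_, ?_⟩, fun _ _ => rfl⟩
    · -- №8 below the top: both truncations read (1.5) at level `j`
      intro m hm j hj
      show B11Eq7Convention.Lam L Ω m j = B11Eq7Convention.Lam L Ω (m + 1) j
      ext y
      rw [mem_lamK_iff_of_lt L Ω hj, mem_lamK_iff_of_lt L Ω (by omega : j < m + 1)]
    · -- №8 at the top: «Ω_m^{(m)} = Λ_m ∪ B(Ω_{m+1}^{(m+1)})»
      intro m hm x
      show x ∈ B11Eq7Convention.Lam L Ω m m ↔ x ∈ B11Eq7Convention.Lam L Ω (m + 1) m ∨ ∃ y ∈ B11Eq7Convention.Lam L Ω (m + 1) (m + 1), x ∈ blockSites L y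
      rw [mem_lamK_self_iff, mem_lamK_iff_of_lt L Ω (Nat.lt_succ_self m), smul_mem_iff_lam_or_block hL hΩ m x]
      refine or_congr Iff.rfl ⟨?_, ?_⟩
      · rintro ⟨y, hy, hxy⟩; exact ⟨y, (mem_lamK_self_iff L Ω (m + 1) y).2 hy, hxy⟩
      · rintro ⟨y, hy, hxy⟩; exact ⟨y, (mem_lamK_self_iff L Ω (m + 1) y).1 hy, hxy⟩
    · -- №11: (1.6) at every level `ℓ ≤ k`
      intro ℓ hℓ w hw
      show ∃ j, ℓ ≤ j ∧ j ≤ k ∧ ∃ y ∈ B11Eq7Convention.Lam L Ω k j, Under L (j - ℓ) y w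
      have hxℓ : loK L ℓ w ∈ Ω ℓ := hw _ (hcorner ℓ w)
      obtain ⟨l, hℓl, hlk, hxl⟩ := exists_layer (Ω := Ω) hℓ hxℓ
      refine ⟨l, hℓl, hlk, flm L (l - ℓ) w, flm_mem_lam_of_mem_layer hL hΩ (x := loK L ℓ w) ?_ hxl, under_flm hL (l - ℓ) w⟩
      have h' := (under_smul_iff hL (l - ℓ) ℓ (flm L (l - ℓ) w) w).2 (under_flm hL (l - ℓ) w)
      rwa [Nat.sub_add_cancel hℓl, ← loK_eq_smul] at h'

variable (θ : Stage3Params)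

/-- ★★★ **UNIVERSALITY — EVERY ADMISSIBLE DOMAIN SEQUENCE IS CARRIED BY A MEMBER OF THE INDEX OF RECORD**: for every spacing `η > 0` and depth `k ≥ 1` with `Lᵏη ≤ 1` (№7) and every
`Ω` with `Ω₀ = ℤᵈ` obeying (1.3)–(1.4), there is `j : IdxB8SubD θ` with `j.η = η`, `j.k = k`, `j.Ω = Ω` and families pinned to print's (`j.Λs = B11Eq7Convention.Lam θ.L Ω`; the (1.5)
predicate of the Subtype is then `mem_lamK_iff_of_lt`, one direction). [cite: Balaban1985RegularSpaces, (1.3)–(1.6) p.77, p.77 («Ω_j = T_η»), (1.68) p.88; Balaban1985Variational, (1)–(3) pp.277–278] -/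
theorem exists_idxB8SubD_of_domainSeq {η : ℝ} (hη : 0 < η) {k : ℕ} (hk : 1 ≤ k) (hscale : (θ.L : ℝ) ^ k * η ≤ 1)
    {Ω : ℕ → Set (Site θ.D)} (hΩ0 : Ω 0 = Set.univ) (hΩ : DomainSeq θ.L Ω) :
    ∃ j : IdxB8SubD θ, j.1.1.1.1.η = η ∧ j.1.1.1.1.k = k ∧ j.1.1.1.1.Ω = Ω ∧ j.1.1.1.1.Λs = B11Eq7Convention.Lam θ.L Ω := by
  obtain ⟨i, hiη, hik, hiΩ, hΛ, -, hlaws⟩ := exists_zdIdx_lam_lawsB (one_le_L θ) hη hk hscale Ω hΩ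
  have hΩ0' : i.Ω 0 = Set.univ := by rw [hiΩ]; exact hΩ0
  have hds : DomainSeq θ.L i.Ω := by rw [hiΩ]; exact hΩ
  have hlam : ∀ l, l < i.k → ∀ z ∈ i.Λs i.k l, ((θ.L : ℤ) ^ l) • z ∈ Lam θ.L i.Ω l := by
    intro l hl z hz
    rw [hΛ] at hz
    rw [hiΩ]
    exact (mem_lamK_iff_of_lt θ.L Ω (hik ▸ hl) z).1 hz
  exact ⟨⟨(⟨⟨⟨i, hΩ0'⟩, hlaws⟩, hds⟩ : IdxB8SubC θ), hlam⟩, hiη, hik, hiΩ, hΛ⟩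

/-- ★★★ **CHARACTERISATION — THE INDEX OF RECORD IS PRINT'S CLASS**: a triple `(η, k, Ω)` is carried by a member of `IdxB8SubD θ` iff it is admissible: `0 < η`, `1 ≤ k`, `Lᵏη ≤ 1`,
`Ω₀ = ℤᵈ`, (1.3)–(1.4).  With §1 (the families on `l ≤ m ≤ k` are then forced), the forgetful map «member ↦ (η, k, Ω)» is onto print's admissible domain sequences and injective on
everything the leaf reads. [cite: Balaban1985RegularSpaces, (1.3)–(1.6) p.77, p.77 («Ω_j = T_η»), (1.68) p.88] -/
theorem exists_idxB8SubD_iff (η : ℝ) (k : ℕ) (Ω : ℕ → Set (Site θ.D)) :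
    (∃ j : IdxB8SubD θ, j.1.1.1.1.η = η ∧ j.1.1.1.1.k = k ∧ j.1.1.1.1.Ω = Ω) ↔
      0 < η ∧ 1 ≤ k ∧ (θ.L : ℝ) ^ k * η ≤ 1 ∧ Ω 0 = Set.univ ∧ DomainSeq θ.L Ω := by
  constructor
  · rintro ⟨j, rfl, rfl, rfl⟩
    exact ⟨j.1.1.1.1.hη, j.1.1.1.1.hk, j.1.1.2.scale, j.1.1.1.2, j.1.2⟩
  · rintro ⟨hη, hk, hscale, hΩ0, hΩ⟩
    obtain ⟨j, h1, h2, h3, -⟩ := exists_idxB8SubD_of_domainSeq θ hη hk hscale hΩ0 hΩ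
    exact ⟨j, h1, h2, h3⟩

end Universality

/-! ## §3 A6 by one line for a named domain family: print's tower `(ℤᵈ, □₁, …, □_k)` at every centre, size and margin -/

section Corollaries

variable (θ : Stage3Params)

/-- ★ **PRINT'S TOWER `(ℤᵈ, □₁, …, □_k)` IS A MEMBER AT EVERY CENTRE `a`, SIZE `M`, MARGIN `ρ ≥ L` AND DEPTH `k ≥ 1`** (spacing `η = L⁻ᵏ`, families pinned to print's level sets of
`cubeFam true θ.L a M ρ k`): r05's `cubeFam_domainSeq` + §2 — generalising `Node00.exists_idxB8SubD_depth` (the one pinned tower `a = 0`, `M = 1`, `ρ = L` of p611723).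
[cite: Balaban1985RegularSpaces, (1.131) p.99, (1.3)–(1.6) p.77, p.98] -/
theorem exists_idxB8SubD_cubeFam (a : Site θ.D) (M : ℕ) {ρ : ℕ} (hρ : θ.L ≤ ρ) {k : ℕ} (hk : 1 ≤ k) :
    ∃ j : IdxB8SubD θ, j.1.1.1.1.η = ((θ.L : ℝ)⁻¹) ^ k ∧ j.1.1.1.1.k = k ∧ j.1.1.1.1.Ω = cubeFam true θ.L a M ρ k ∧
      j.1.1.1.1.Λs = B11Eq7Convention.Lam θ.L (cubeFam true θ.L a M ρ k) := by
  have hL : 1 ≤ θ.L := one_le_L θ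
  have hL0 : (0 : ℝ) < θ.L := by exact_mod_cast (show 0 < θ.L by omega)
  have hη : (0 : ℝ) < ((θ.L : ℝ)⁻¹) ^ k := pow_pos (inv_pos.mpr hL0) k
  have hscale : (θ.L : ℝ) ^ k * ((θ.L : ℝ)⁻¹) ^ k ≤ 1 := by
    rw [← mul_pow, mul_inv_cancel₀ hL0.ne', one_pow]
  exact exists_idxB8SubD_of_domainSeq θ hη hk hscale (cubeFam_true_zero θ.L a M ρ k) (cubeFam_domainSeq true hL a M hρ k)

/-- ★★ **PRINT'S LITERAL (1.3)–(1.4) IS CARRIED**: every sequence `Ω₀ = ℤᵈ ⊃ Ω₁ ⊃ … ⊃ Ω_k` admissible in print's sense — `Ω_j = Bʲ(Ω_j^{(j)})`, «Ω_j is a sum of cubes of a size M₁Lʲη»,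
«(Lʲη)⁻¹dist(Ω_jᶜ, Ω_{j+1}) > RM₁» with `RM₁ ≥ L` (r05's `B8Eq134Admissible.Admissible134`, its `domainSeq` reading) — is, at every spacing `η > 0` with `Lᵏη ≤ 1`, the domain sequence of a
member of `IdxB8SubD θ` with families pinned to print's.  The typed index asks NO MORE than print's (1.3)–(1.5).
[cite: Balaban1985RegularSpaces, (1.3)–(1.6) p.77, p.77 («Ω_j = T_η», «R … a power of L», «M₁ … much bigger than δ₀⁻¹»)] -/
theorem exists_idxB8SubD_of_admissible134 {M₁ R k : ℕ} (hk : 1 ≤ k) (hRM : θ.L ≤ R * M₁) {Ω : ℕ → Set (Site θ.D)}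
    (h : Admissible134 θ.L M₁ R k Ω) (hΩ0 : Ω 0 = Set.univ) {η : ℝ} (hη : 0 < η) (hscale : (θ.L : ℝ) ^ k * η ≤ 1) :
    ∃ j : IdxB8SubD θ, j.1.1.1.1.η = η ∧ j.1.1.1.1.k = k ∧ j.1.1.1.1.Ω = Ω ∧ j.1.1.1.1.Λs = B11Eq7Convention.Lam θ.L Ω :=
  exists_idxB8SubD_of_domainSeq θ hη hk hscale hΩ0 (h.domainSeq (one_le_L θ) hRM)

/-- **r05's Sect.-F single cube `(ℤᵈ, [0, Lm)ᵈ, ∅, ∅, …)` (`B8ConstraintBonds.cubeSeq`) is carried at every depth `k ≥ 1`** (spacing `L⁻ᵏ`; the levels `≥ 2` are empty, which (1.3)–(1.5)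
admit). [cite: Balaban1985RegularSpaces, Sect. F p.98, (1.3)–(1.6) p.77] -/
theorem exists_idxB8SubD_cubeSeq (m : ℕ) {k : ℕ} (hk : 1 ≤ k) :
    ∃ j : IdxB8SubD θ, j.1.1.1.1.η = ((θ.L : ℝ)⁻¹) ^ k ∧ j.1.1.1.1.k = k ∧ j.1.1.1.1.Ω = cubeSeq θ.D θ.L m ∧
      j.1.1.1.1.Λs = B11Eq7Convention.Lam θ.L (cubeSeq θ.D θ.L m) := by
  have hL : 1 ≤ θ.L := one_le_L θ
  have hL0 : (0 : ℝ) < θ.L := by exact_mod_cast (show 0 < θ.L by omega)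
  have hη : (0 : ℝ) < ((θ.L : ℝ)⁻¹) ^ k := pow_pos (inv_pos.mpr hL0) k
  have hscale : (θ.L : ℝ) ^ k * ((θ.L : ℝ)⁻¹) ^ k ≤ 1 := by
    rw [← mul_pow, mul_inv_cancel₀ hL0.ne', one_pow]
  exact exists_idxB8SubD_of_domainSeq θ hη hk hscale rfl (cubeSeq_domainSeq θ.D hL m)

/-- ★ **TRUNCATIONS OF MEMBERS ARE MEMBERS** ((1.68): the truncated sequence `{Ω_j}_{j ≤ m}` «satisfies the same conditions», the induction of Theorem 4): for `j : IdxB8SubD θ` and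
`1 ≤ m ≤ k` there is a member with the same spacing and domains and depth `m`, whose constraint families AGREE with `j`'s on every level `l ≤ m' ≤ m` (§2 at `(η, m, Ω)` — №7 by
`Lᵐη ≤ Lᵏη ≤ 1` — then §1 twice). [cite: Balaban1985RegularSpaces, (1.68) p.88, (1.3)–(1.6) p.77] -/
theorem IdxB8SubD.exists_truncation {θ : Stage3Params} (j : IdxB8SubD θ) {m : ℕ} (h1m : 1 ≤ m) (hmk : m ≤ j.1.1.1.1.k) :
    ∃ j' : IdxB8SubD θ, j'.1.1.1.1.η = j.1.1.1.1.η ∧ j'.1.1.1.1.k = m ∧ j'.1.1.1.1.Ω = j.1.1.1.1.Ω ∧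
      ∀ m', m' ≤ m → ∀ l, l ≤ m' → j'.1.1.1.1.Λs m' l = j.1.1.1.1.Λs m' l := by
  have hL1 : (1 : ℝ) ≤ θ.L := by exact_mod_cast one_le_L θ
  have hscale : (θ.L : ℝ) ^ m * j.1.1.1.1.η ≤ 1 :=
    le_trans (mul_le_mul_of_nonneg_right (pow_le_pow_right₀ hL1 hmk) j.1.1.1.1.hη.le) j.1.1.2.scale
  obtain ⟨j', hη, hk, hΩ, -⟩ := exists_idxB8SubD_of_domainSeq θ j.1.1.1.1.hη h1m hscale j.1.1.1.2 j.1.2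
  refine ⟨j', hη, hk, hΩ, fun m' hm' l hl => ?_⟩
  rw [IdxB8SubD.Λs_eq_lam j' (hk ▸ hm') hl, IdxB8SubD.Λs_eq_lam j (hm'.trans hmk) hl, hΩ]

end Corollaries

end Literature.MathematicalPhysics.QuantumFieldTheory.Balaban1983to89.B8IdxB8SubDRigidity

end
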